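import Mathlib
import Summits.ResolutionOfSingularities.ResolutionOfSingularities.Theorems.HomologicalConductorPersistencePointedCeilingAssembly
import Summits.ResolutionOfSingularities.ResolutionOfSingularities.Theorems.HomologicalConductorPersistenceHeightOneReflexive
import Summits.ResolutionOfSingularities.ResolutionOfSingularities.Theorems.HomologicalConductorPersistenceConductorCeiling
import Summits.ResolutionOfSingularities.ResolutionOfSingularities.Theorems.HomologicalConductorNoZenoExcDegreeNonzero
import Literature.AlgebraicGeometry.Resolution.FundamentalLocus
import HarnessLib

/-!
# [OURS · L1 w44b] K-PCC sheaf half, FILE 4b: the CURVETTE DICTIONARY and the pointed ceiling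
# `ca³(T) ⊆ 𝔭·𝔭⁻¹ ⊆ I(Z⁽ᵗ⁾ − A⁽ᵗ⁾)` for the prime `𝔭` of a curvette (K-PCC Thm 2.3 in the kernel)

Rung S-2 `HomologicalConductor.PersistenceSurface` (stmt-ResolutionOfSingularities-19970), route
`ResolutionOfSingularities/HomologicalConductor`, chain W4.4b (cell res-hironaka), WAVE-3 row «stub-3 → K-PCC SHEAF HALF»
(lead memo K-PCC, res-L1-w44b-lead-1 g4, Thm 2.3). `[OURS · L1 w44b]`; replaces the role of no printed item; NOT a
statement of the manuscript under review; AI-written, weaker than expert review. Assembles FILE 3 `…PointedCeilingAssembly`,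
FILE 4a `…HeightOneReflexive`, lead-1's `PersistenceConductorCeiling.algebraMap_mem_mul_inv_of_isReflexive` (p553024), the
lead's lattice `…PersistencePointedCyclesDefinite`, and the tree's `FundamentalLocus`. Setting: `T` a normal noetherian
local domain of dimension `2`, `π : X → Spec T` proper birational, `X` integral, locally noetherian, regular; `γ ∈ X` a
codimension-one point OFF the closed fibre (generic point of a curvette `Γ`), `𝔭 = π(γ)` its height-one prime.

* `height_le_one_of_ne_maximalIdeal`, `isIso_stalkMap_of_base_ne_closedPoint`, `eq_of_base_eq_of_ne_closedPoint` — off the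
  closed fibre: primes of height `≤ 1`, `𝒪_{X,x} = T_{π x}`, one point of `X` per point of `Spec T`;
* **`neg_primeDivisor_isSectionOn_base`** (`𝔭 ⊆ H⁰(X∖E, 𝒪(−Γ))`), **`primeDivisor_isSectionOn_of_mul_base_mem`**
  (`𝔭⁻¹ ⊆ H⁰(X∖E, 𝒪(Γ))`, through `exists_mem_base_ord_eq_one`: an `a ∈ 𝔭` of order `1` at `γ`);
* **`least_sub_greatest_le_ord_of_mem_cohomologyAnnihilatorOfDegree_three`** — if `(Γ·C_i) = δ_it` then every non-zero
  `x ∈ ca³(T)` has `ord_{E_i}(x) ≥ Z₀ i − A₀ i` (`Z₀`, `A₀`, `hneg` as in the lead's lattice): `x ∈ 𝔭·𝔭⁻¹`, each product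
  `a·v` obeys the bound by FILE 3, sums by `ord_add`.

References: J. Lipman, Publ. Math. IHÉS 36 (1969), §12, §18 [`Lipman1969`]; S. B. Iyengar, R. Takahashi, IMRN 2016, Rem. 2.13
[`IyengarTakahashi2014`]; memo K-PCC (this work).
-/

set_option linter.dupNamespace false
set_option autoImplicit false

noncomputable section

open CategoryTheory AlgebraicGeometry TopologicalSpace IsLocalRing Opposite Order
open Literature.AlgebraicGeometry.Motives Literature.AlgebraicGeometry.Motives.RatFn
open Literature.AlgebraicGeometry.Resolution Literature.RingTheory.CohomologyAnnihilator
open Summit.ResolutionOfSingularities.ResolutionOfSingularities.Theorems.NoZeno.SandwichCluster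
open Summit.ResolutionOfSingularities.ResolutionOfSingularities.Theorems.NoZeno.ExcCount

universe u

namespace Summit.ResolutionOfSingularities.ResolutionOfSingularities.Theorems.HomologicalConductor.PersistencePointedCeiling

variable {X : Scheme.{u}} [IsIntegral X] {T : Type u} [CommRing T] [IsLocalRing T] [IsDomain T]
  [IsNoetherianRing T] [IsIntegrallyClosed T] (π : X ⟶ Spec (.of T))

omit [IsDomain T] [IsNoetherianRing T] [IsIntegrallyClosed T] in
/-- In a local ring of dimension `≤ 2`, a prime other than the maximal ideal has height `≤ 1`. [folklore] -/
theorem height_le_one_of_ne_maximalIdeal (hT2 : ringKrullDim T ≤ 2) {Q : Ideal T} [Q.IsPrime]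
    (hQ : Q ≠ maximalIdeal T) : Q.height ≤ 1 := by
  have hlt : Q < maximalIdeal T := lt_of_le_of_ne (le_maximalIdeal Ideal.IsPrime.ne_top') hQ
  have h1 := Ideal.height_add_one_le_of_lt_of_isPrime hlt
  have hm := IsLocalRing.maximalIdeal_height_eq_ringKrullDim (R := T)
  have h2 : ((maximalIdeal T).height : WithBot ℕ∞) ≤ 2 := by rw [hm]; exact hT2
  have h3 : (maximalIdeal T).height ≤ 2 := by
    rw [show (2 : WithBot ℕ∞) = ((2 : ℕ∞) : WithBot ℕ∞) from rfl, WithBot.coe_le_coe] at h2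
    exact h2
  have hfin : Q.height ≠ ⊤ := by
    intro h; rw [h] at h1; exact absurd (h1.trans h3) (by decide)
  obtain ⟨n, hn⟩ := ENat.ne_top_iff_exists.mp hfin
  rw [← hn] at h1 ⊢
  have h4 : ((n + 1 : ℕ) : ℕ∞) ≤ 2 := by push_cast; exact h1.trans h3
  have : n + 1 ≤ 2 := by exact_mod_cast h4
  exact_mod_cast (by omega : n ≤ 1)

/-- **Off the closed fibre the stalk maps are isomorphisms** (`𝒪_{X,x} = T_{π x}`): `π x` has height `≤ 1`,
so `T_{π x}` is a valuation ring, birationally dominated by `𝒪_{X,x}` (tree `FundamentalLocus`).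
[cite: Matsumura1987, Thm. 11.2] -/
theorem isIso_stalkMap_of_base_ne_closedPoint [IsProper π] (hπ : IsBirational π) (hT2 : ringKrullDim T ≤ 2)
    {x : X} (hx : π.base x ≠ closedPoint T) : IsIso (π.stalkMap x) := by
  haveI : IsDominant π := hπ.isDominant
  have hQ : (π.base x).asIdeal ≠ maximalIdeal T := fun h => hx (PrimeSpectrum.ext h)
  have hval := FullSheaf.valuationRing_stalk_of_height_le_one (T := T) (π.base x)
    (height_le_one_of_ne_maximalIdeal hT2 hQ)
  exact isIso_stalkMap_of_valuationRing_stalk π hπ.isIso_stalkMap_genericPoint x hval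

/-- **A point off the closed fibre is determined by its image** (the fibre of the separated birational `π`
over a valuation-ring point has at most one point). [cite: StacksProject, Tag 01KZ] -/
theorem eq_of_base_eq_of_ne_closedPoint [IsProper π] (hπ : IsBirational π) (hT2 : ringKrullDim T ≤ 2)
    {x x' : X} (hx : π.base x ≠ closedPoint T) (he : π.base x' = π.base x) : x' = x := by
  haveI : IsDominant π := hπ.isDominant
  have hQ : (π.base x).asIdeal ≠ maximalIdeal T := fun h => hx (PrimeSpectrum.ext h)
  have hval := FullSheaf.valuationRing_stalk_of_height_le_one (T := T) (π.base x)
    (height_le_one_of_ne_maximalIdeal hT2 hQ)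
  exact subsingleton_preimage_singleton_of_valuationRing_stalk π hπ.isIso_stalkMap_genericPoint (π.base x)
    hval he rfl

omit [IsLocalRing T] [IsDomain T] [IsNoetherianRing T] [IsIntegrallyClosed T] in
/-- Base functions are regular everywhere. [folklore] -/
theorem isRegularAt_baseToFunctionField (x : X) (a : T) : IsRegularAt x (baseToFunctionField π a) :=
  ⟨_, (FullSheaf.baseToFunctionField_eq_toFunctionField_stalkMap π x a).symm⟩

section Curvette

variable [IsLocallyNoetherian X]

omit [IsLocalRing T] [IsDomain T] [IsNoetherianRing T] [IsIntegrallyClosed T] in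
/-- **`𝔭 ⊆ H⁰(X∖E, 𝒪_X(−Γ))`**: for the codimension-one point `γ` and `a ∈ 𝔭 = π(γ)`, the base function `a`
is a section of `𝒪_X(−[Γ])` (`[Γ]` the prime divisor of `γ`) at every point `x` of codimension `≤ 1` — at
`x = γ` because `a ∈ 𝔪_γ = (g)`, elsewhere because `[Γ]` avoids `x`. [cite: GortzWedhorn2020, (11.9) (p. 374)] -/
theorem neg_primeDivisor_isSectionOn_base (hX : Scheme.IsRegular X) {γ : X} (hγ : coheight γ = 1)
    {a : T} (ha : a ∈ (π.base γ).asIdeal) :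
    (-(CartierDivisor.ofIsEffectiveCartier (primeDivisorIdeal γ)
      (isEffectiveCartier_primeDivisorIdeal_of_isRegular hX hγ))).IsSectionOn
      {x | coheight x ≤ 1} (baseToFunctionField π a) := by
  set I := primeDivisorIdeal γ
  set hI := isEffectiveCartier_primeDivisorIdeal_of_isRegular hX hγ
  intro j x hxj hxc
  rw [CartierDivisor.neg_f]
  have hxj' : x ∈ (CartierDivisor.cartierChart I hI j : X.Opens) := hxj
  have hxc' : coheight x ≤ 1 := hxc
  by_cases hγx : γ ⤳ x
  · -- `x = γ`: `a ∈ 𝔪_γ = (g)`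
    have hxγ : γ = x := eq_of_specializes_of_coheight_le hγx
      (by intro h; rw [h] at hxc'; exact absurd hxc' (by decide)) (by rw [hγ]; exact hxc')
    subst hxγ
    obtain ⟨α, hα⟩ := isRegularAt_baseToFunctionField π γ a
    have hαm : α ∈ maximalIdeal (X.presheaf.stalk γ) := by
      rw [IsLocalRing.mem_maximalIdeal, mem_nonunits_iff]
      intro hu
      have : IsUnitAt γ (baseToFunctionField π a) := ⟨hu.unit, by rw [← hα]; rfl⟩
      exact (isUnitAt_baseToFunctionField_iff π γ a).mp this ha
    rw [← stalkIdeal_primeDivisorIdeal_self γ, stalkIdeal_eq_span_germ_cartierGen_of_mem I hI hxj',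
      Ideal.mem_span_singleton'] at hαm
    obtain ⟨c, hc⟩ := hαm
    refine ⟨c, ?_⟩
    have hg0 : toFunctionField γ ((X.presheaf.germ _ γ hxj').hom (CartierDivisor.cartierGen I hI j)) ≠ 0 :=
      (map_ne_zero_iff _ (toFunctionField_injective γ)).mpr (germ_cartierGen_ne_zero I hI hxj')
    rw [CartierDivisor.ofIsEffectiveCartier_f, ← toFunctionField_germ_eq_secFn
      (CartierDivisor.mem_cartierChart I hI j) hxj', ← hα, ← hc, map_mul, mul_left_comm,
      inv_mul_cancel₀ hg0, mul_one]
  · -- `[Γ]` avoids `x`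
    have hav : (CartierDivisor.ofIsEffectiveCartier I hI).Avoids x := by
      rw [CartierDivisor.avoids_ofIsEffectiveCartier_iff, mem_support_primeDivisorIdeal_iff]
      exact hγx
    exact ((hav j hxj).inv.isRegularAt).mul (isRegularAt_baseToFunctionField π x a)

omit [IsLocalRing T] [IsDomain T] [IsNoetherianRing T] [IsIntegrallyClosed T] in
/-- **An element of `𝔭` of order exactly `1` at `γ`**: when the stalk map at `γ` is an isomorphism, the
uniformizer of `𝒪_{X,γ}` is `a/s` with `a, s ∈ T`, `s ∉ 𝔭`; then `a ∈ 𝔭` and `ord_γ(a) = 1`. [folklore] -/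
theorem exists_mem_base_ord_eq_one (hX : Scheme.IsRegular X) {γ : X} (hγ : coheight γ = 1)
    [IsIso (π.stalkMap γ)] :
    ∃ a ∈ (π.base γ).asIdeal, Scheme.ord (baseToFunctionField π a) γ = 1 := by
  set I := primeDivisorIdeal γ
  set hI := isEffectiveCartier_primeDivisorIdeal_of_isRegular hX hγ
  have hγc := CartierDivisor.mem_cartierChart I hI γ
  set g := (X.presheaf.germ _ γ hγc).hom (CartierDivisor.cartierGen I hI γ) with hgdef
  have hg0 : g ≠ 0 := germ_cartierGen_ne_zero I hI hγc
  have hspan : Ideal.span {g} = maximalIdeal (X.presheaf.stalk γ) ^ 1 := by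
    rw [pow_one, ← stalkIdeal_primeDivisorIdeal_self γ, stalkIdeal_eq_span_germ_cartierGen_of_mem I hI hγc]
  have hordg : Scheme.ord (toFunctionField γ g) γ = 1 := by
    exact_mod_cast ord_toFunctionField_eq_of_span_eq hX hγ hg0 hspan
  obtain ⟨a, s, hs, has⟩ := FullSheaf.exists_mul_base_eq_base_of_isIso_stalkMap π γ g
  have hsu : IsUnitAt γ (baseToFunctionField π s) := (isUnitAt_baseToFunctionField_iff π γ s).mpr hs
  have hs0 : baseToFunctionField π s ≠ 0 := hsu.ne_zero
  have htg0 : toFunctionField γ g ≠ 0 := (map_ne_zero_iff _ (toFunctionField_injective γ)).mpr hg0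
  have horda : Scheme.ord (baseToFunctionField π a) γ = 1 := by
    rw [← has, Scheme.ord_mul htg0 hs0, hordg, hsu.ord_eq_zero, add_zero]
  refine ⟨a, ?_, horda⟩
  -- `a ∈ 𝔭`: `a` is not a unit at `γ` (order `1`)
  by_contra ha
  have hu : IsUnitAt γ (baseToFunctionField π a) := (isUnitAt_baseToFunctionField_iff π γ a).mpr ha
  have := hu.ord_eq_zero
  rw [horda] at this
  exact one_ne_zero this

/-- **`𝔭⁻¹ ⊆ H⁰(X∖E, 𝒪_X(Γ))`**: `π` proper birational over a normal noetherian local domain of dimension `≤ 2`;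
if `v ∈ K(X)` multiplies `𝔭 = π(γ)` into `T` (`v ∈ 𝔭⁻¹`), then `v` is a section of `𝒪_X([Γ])` at every point
`x` of codimension `≤ 1` off the closed fibre: at `x = γ` by `ord_γ v ≥ −1` (tested on `a ∈ 𝔭` of order `1`);
at `x ≠ γ`, `π x ⊉ 𝔭` (else `π x = 𝔭` and `x = γ`), so some `a ∈ 𝔭` is a unit at `x` and `v = (va)·a⁻¹`.
[cite: GortzWedhorn2020, (11.9) (p. 374)] -/
theorem primeDivisor_isSectionOn_of_mul_base_mem (hX : Scheme.IsRegular X) {γ : X} (hγ : coheight γ = 1)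
    [IsProper π] (hπ : IsBirational π) (hT2 : ringKrullDim T ≤ 2)
    (hγE : π.base γ ≠ closedPoint T) {v : X.functionField}
    (hv : ∀ a ∈ (π.base γ).asIdeal, ∃ b : T, v * baseToFunctionField π a = baseToFunctionField π b) :
    (CartierDivisor.ofIsEffectiveCartier (primeDivisorIdeal γ)
      (isEffectiveCartier_primeDivisorIdeal_of_isRegular hX hγ)).IsSectionOn
      {x | π.base x ≠ closedPoint T ∧ coheight x ≤ 1} v := by
  set I := primeDivisorIdeal γ
  set hI := isEffectiveCartier_primeDivisorIdeal_of_isRegular hX hγ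
  haveI := isIso_stalkMap_of_base_ne_closedPoint π hπ hT2 hγE
  rintro j x hxj ⟨hxE, hxc⟩
  have hxj' : x ∈ (CartierDivisor.cartierChart I hI j : X.Opens) := hxj
  have hxc' : coheight x ≤ 1 := hxc
  by_cases hv0 : v = 0
  · rw [hv0, mul_zero]; exact isRegularAt_zero
  by_cases hγx : γ ⤳ x
  · -- `x = γ`: orders
    have hxγ : γ = x := eq_of_specializes_of_coheight_le hγx
      (by intro h; rw [h] at hxc'; exact absurd hxc' (by decide)) (by rw [hγ]; exact hxc')
    subst hxγ
    obtain ⟨a, ha, horda⟩ := exists_mem_base_ord_eq_one π hX hγ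
    obtain ⟨b, hb⟩ := hv a ha
    have ha0 : baseToFunctionField π a ≠ 0 := by
      intro h0; rw [h0, Scheme.ord_zero] at horda; exact zero_ne_one horda
    have hb0 : baseToFunctionField π b ≠ 0 := by rw [← hb]; exact mul_ne_zero hv0 ha0
    have hordv : -1 ≤ Scheme.ord v γ := by
      have h1 := (isRegularAt_baseToFunctionField π γ b).ord_nonneg
      rw [← hb, Scheme.ord_mul hv0 ha0, horda] at h1
      omega
    -- the local equation `g_j` has order `1` at `γ`
    have hg0 := germ_cartierGen_ne_zero I hI hxj'
    have hordg : Scheme.ord ((CartierDivisor.ofIsEffectiveCartier I hI).f j) γ = 1 := by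
      rw [CartierDivisor.ofIsEffectiveCartier_f, ← toFunctionField_germ_eq_secFn
        (CartierDivisor.mem_cartierChart I hI j) hxj']
      have hspan : Ideal.span {(X.presheaf.germ _ γ hxj').hom (CartierDivisor.cartierGen I hI j)} =
          maximalIdeal (X.presheaf.stalk γ) ^ 1 := by
        rw [pow_one, ← stalkIdeal_primeDivisorIdeal_self γ, stalkIdeal_eq_span_germ_cartierGen_of_mem I hI hxj']
      exact_mod_cast ord_toFunctionField_eq_of_span_eq hX hγ hg0 hspan
    refine isRegularAt_of_ord_nonneg (hX γ) hγ
      (mul_ne_zero ((CartierDivisor.ofIsEffectiveCartier I hI).f_ne_zero j) hv0) ?_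
    rw [Scheme.ord_mul ((CartierDivisor.ofIsEffectiveCartier I hI).f_ne_zero j) hv0, hordg]
    omega
  · -- `x ≠ γ` off the closed fibre: some `a ∈ 𝔭` is a unit at `x`
    have hav : (CartierDivisor.ofIsEffectiveCartier I hI).Avoids x := by
      rw [CartierDivisor.avoids_ofIsEffectiveCartier_iff, mem_support_primeDivisorIdeal_iff]
      exact hγx
    have hne : ¬ (π.base γ).asIdeal ≤ (π.base x).asIdeal := by
      intro hle
      -- both primes have height `≤ 1`, `𝔭` has height `1`: equal, hence `x = γ`
      have hQ : (π.base x).asIdeal ≠ maximalIdeal T := fun h => hxE (PrimeSpectrum.ext h)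
      have hxh := height_le_one_of_ne_maximalIdeal hT2 hQ
      have hxc1 := hxc'
      have hγh : ((π.base γ).asIdeal).height = 1 := by
        have hd := ringKrullDim_stalk_eq_coheight γ
        rw [hγ] at hd
        have e := (asIso (π.stalkMap γ)).commRingCatIsoToRingEquiv
        have hd' : ringKrullDim ((Spec (.of T)).presheaf.stalk (π.base γ)) = (1 : ℕ∞) := by
          rw [ringKrullDim_eq_of_ringEquiv e]; exact hd
        letI : Algebra T ((Spec (.of T)).presheaf.stalk (π.base γ)) :=
          StructureSheaf.stalkAlgebra T (π.base γ)
        haveI : IsLocalization.AtPrime ((Spec (.of T)).presheaf.stalk (π.base γ)) (π.base γ).asIdeal :=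
          StructureSheaf.IsLocalization.to_stalk T (π.base γ)
        rw [IsLocalization.AtPrime.ringKrullDim_eq_height (π.base γ).asIdeal
          ((Spec (.of T)).presheaf.stalk (π.base γ))] at hd'
        exact_mod_cast hd'
      haveI : ((π.base γ).asIdeal).FiniteHeight :=
        Ideal.finiteHeight_iff_lt.mpr (Or.inr (by rw [hγh]; exact ENat.coe_lt_top 1))
      have heq : (π.base γ).asIdeal = (π.base x).asIdeal :=
        Ideal.eq_of_le_of_height_le (π.base γ).asIdeal hle (hxh.trans hγh.ge)
      have hxg : x = γ := eq_of_base_eq_of_ne_closedPoint π hπ hT2 hγE (PrimeSpectrum.ext heq).symm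
      exact hγx (hxg ▸ specializes_refl x)
    obtain ⟨a, haγ, hax⟩ := Set.not_subset.mp hne
    obtain ⟨b, hb⟩ := hv a haγ
    have hau : IsUnitAt x (baseToFunctionField π a) := (isUnitAt_baseToFunctionField_iff π x a).mpr hax
    have hvreg : IsRegularAt x v := by
      have e : v = baseToFunctionField π b * (baseToFunctionField π a)⁻¹ := by
        rw [← hb, mul_inv_cancel_right₀ hau.ne_zero]
      rw [e]
      exact (isRegularAt_baseToFunctionField π x b).mul hau.inv.isRegularAt
    exact (hav j hxj).isRegularAt.mul hvreg

end Curvette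

section Ceiling

variable [IsLocallyNoetherian X] [IsProper π] [DecidableEq X]

/-- **THE POINTED CEILING FOR A CURVETTE (K-PCC Thm 2.3 in the kernel).** `T` a normal noetherian local domain of
Krull dimension `2`, `π : X → Spec T` proper birational, `X` integral, locally noetherian and regular; `F` the finite
set of integral exceptional curves, containing every codimension-`≤ 1` point of the closed fibre, indexing the
lattice `M j i = ([E_j]·E_i)`; `hneg`: the intersection form is negative definite; `γ` a codimension-one point off
the closed fibre whose prime divisor `[Γ]` has `([Γ]·E_i) = δ_it` (a curvette at `C_t`), `𝔭 = π(γ)`; `Z₀` below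
every effective cycle pointed anti-nef at `t`, `A₀` above every effective cycle almost nef at `t` (e.g. `Z⁽ᵗ⁾`,
`A⁽ᵗ⁾`). Then every non-zero `x ∈ ca³(T)` has **`ord_{E_i}(x) ≥ Z₀ i − A₀ i` for every `i`**: `x ∈ 𝔭·𝔭⁻¹`
(reflexive rank-one ceiling — `𝔭` is reflexive, FILE 4a), and every product `a·v` (`a ∈ 𝔭 ⊆ H⁰(X∖E, 𝒪(−Γ))`,
`v ∈ 𝔭⁻¹ ⊆ H⁰(X∖E, 𝒪(Γ))`) satisfies the bound (FILE 3); sums by `ord(f + g) ≥ min`.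
[cite: Lipman1969, Section 12 (pp. 220–221)] [cite: IyengarTakahashi2014, Remark 2.13] -/
theorem least_sub_greatest_le_ord_of_mem_cohomologyAnnihilatorOfDegree_three (hX : Scheme.IsRegular X)
    (hπ : IsBirational π) (hT : ringKrullDim T = 2) (F : Finset X)
    (hF : ∀ η ∈ F, coheight η = 1) (hFexc : ∀ η ∈ F, η ∈ excCurvePoints π)
    (hFE : ∀ ζ : X, π ζ = closedPoint T → coheight ζ ≤ 1 → ζ ∈ F)
    (hneg : ∀ N : {η // η ∈ F} → ℤ, 0 ≤ ∑ i, N i * ∑ j, N j *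
        excCurveDegree π (CartierDivisor.ofIsEffectiveCartier (primeDivisorIdeal (j : X))
          (isEffectiveCartier_primeDivisorIdeal_of_isRegular hX (hF j j.2))) i → N = 0)
    (t : {η // η ∈ F}) {γ : X} (hγ : coheight γ = 1) (hγE : π.base γ ≠ closedPoint T)
    (hΓ : ∀ i : {η // η ∈ F}, excCurveDegree π (CartierDivisor.ofIsEffectiveCartier (primeDivisorIdeal γ)
      (isEffectiveCartier_primeDivisorIdeal_of_isRegular hX hγ)) i = (if i = t then 1 else 0))
    (Z₀ A₀ : {η // η ∈ F} → ℕ)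
    (hZ₀ : ∀ Z : {η // η ∈ F} → ℕ, (∀ i : {η // η ∈ F}, ∑ j, (Z j : ℤ) *
        excCurveDegree π (CartierDivisor.ofIsEffectiveCartier (primeDivisorIdeal (j : X))
          (isEffectiveCartier_primeDivisorIdeal_of_isRegular hX (hF j j.2))) i ≤
        -(if i = t then 1 else 0)) → Z₀ ≤ Z)
    (hA₀ : ∀ A : {η // η ∈ F} → ℕ, (∀ i : {η // η ∈ F}, -(if i = t then (1 : ℤ) else 0) ≤ ∑ j, (A j : ℤ) *
        excCurveDegree π (CartierDivisor.ofIsEffectiveCartier (primeDivisorIdeal (j : X))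
          (isEffectiveCartier_primeDivisorIdeal_of_isRegular hX (hF j j.2))) i) → A ≤ A₀)
    {x : T} (hx : x ∈ cohomologyAnnihilatorOfDegree T 3) (hx0 : x ≠ 0) (i : {η // η ∈ F}) :
    (Z₀ i : ℤ) - A₀ i ≤ Scheme.ord (baseToFunctionField π x) i := by
  classical
  -- `K(X) = Frac T` along `baseToFunctionField`
  letI := (baseToFunctionField π).toAlgebra
  haveI : IsDominant π := hπ.isDominant
  haveI : IsFractionRing T X.functionField :=
    isFractionRing_baseToFunctionField π hπ.isIso_stalkMap_genericPoint
  have halg : ∀ a : T, algebraMap T X.functionField a = baseToFunctionField π a := fun _ => rfl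
  -- the prime `𝔭 = π γ`, of height one, reflexive
  set 𝔭 : Ideal T := (π.base γ).asIdeal with h𝔭def
  haveI : 𝔭.IsPrime := (π.base γ).isPrime
  haveI := isIso_stalkMap_of_base_ne_closedPoint π hπ hT.le hγE
  have h𝔭1 : 𝔭.height = 1 := by
    have hd := ringKrullDim_stalk_eq_coheight γ
    rw [hγ] at hd
    have e := (asIso (π.stalkMap γ)).commRingCatIsoToRingEquiv
    have hd' : ringKrullDim ((Spec (.of T)).presheaf.stalk (π.base γ)) = (1 : ℕ∞) := by
      rw [ringKrullDim_eq_of_ringEquiv e]; exact hd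
    letI : Algebra T ((Spec (.of T)).presheaf.stalk (π.base γ)) := StructureSheaf.stalkAlgebra T (π.base γ)
    haveI : IsLocalization.AtPrime ((Spec (.of T)).presheaf.stalk (π.base γ)) (π.base γ).asIdeal :=
      StructureSheaf.IsLocalization.to_stalk T (π.base γ)
    rw [IsLocalization.AtPrime.ringKrullDim_eq_height (π.base γ).asIdeal
      ((Spec (.of T)).presheaf.stalk (π.base γ))] at hd'
    exact_mod_cast hd'
  haveI : Module.IsReflexive T ↥𝔭 := isReflexive_of_height_eq_one 𝔭 h𝔭1
  have h𝔭0 : 𝔭 ≠ ⊥ := Ideal.ne_bot_of_height_eq_one h𝔭1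
  -- `x ∈ 𝔭·𝔭⁻¹`
  have hxmem := PersistenceConductorCeiling.algebraMap_mem_mul_inv_of_isReflexive
    (K := X.functionField) 𝔭 h𝔭0 hx
  rw [halg] at hxmem
  -- the divisors `D = −[Γ]`, `−D`
  set DΓ := CartierDivisor.ofIsEffectiveCartier (primeDivisorIdeal γ)
    (isEffectiveCartier_primeDivisorIdeal_of_isRegular hX hγ) with hDΓ
  have hD : ∀ i : {η // η ∈ F}, excCurveDegree π (-DΓ) i = -(if i = t then 1 else 0) := fun i => by
    rw [excCurveDegree_neg π (hFexc i i.2), hΓ i]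
  -- every point off the closed fibre has codimension `≤ 1` (its local ring is `T_{π x}`)
  have hcoh : ∀ y : X, π.base y ≠ closedPoint T → coheight y ≤ 1 := by
    intro y hy
    haveI := isIso_stalkMap_of_base_ne_closedPoint π hπ hT.le hy
    have hQ : (π.base y).asIdeal ≠ maximalIdeal T := fun h => hy (PrimeSpectrum.ext h)
    have hh := height_le_one_of_ne_maximalIdeal hT.le hQ
    have hd := ringKrullDim_stalk_eq_coheight y
    have e := (asIso (π.stalkMap y)).commRingCatIsoToRingEquiv
    letI : Algebra T ((Spec (.of T)).presheaf.stalk (π.base y)) := StructureSheaf.stalkAlgebra T (π.base y)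
    haveI : IsLocalization.AtPrime ((Spec (.of T)).presheaf.stalk (π.base y)) (π.base y).asIdeal :=
      StructureSheaf.IsLocalization.to_stalk T (π.base y)
    have hd' : (((π.base y).asIdeal.height : ℕ∞) : WithBot ℕ∞) = coheight y := by
      rw [← IsLocalization.AtPrime.ringKrullDim_eq_height (π.base y).asIdeal
        ((Spec (.of T)).presheaf.stalk (π.base y)), ringKrullDim_eq_of_ringEquiv e, hd]
    have : (coheight y : WithBot ℕ∞) ≤ (1 : ℕ∞) := by rw [← hd']; exact_mod_cast hh
    exact_mod_cast this
  -- the target predicate, closed under sums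
  let C : X.functionField → Prop := fun h => h = 0 ∨ ∀ i : {η // η ∈ F}, (Z₀ i : ℤ) - A₀ i ≤ Scheme.ord h i
  have hC : C (baseToFunctionField π x) := by
    rw [← FractionalIdeal.mem_coe, FractionalIdeal.coe_mul] at hxmem
    refine Submodule.mul_induction_on hxmem (fun m hm n hn => ?_) (fun y z hy hz => ?_)
    · -- products `a · v`, `a ∈ 𝔭`, `v ∈ 𝔭⁻¹`
      rw [FractionalIdeal.mem_coe, FractionalIdeal.mem_coeIdeal] at hm
      obtain ⟨a, ha𝔭, rfl⟩ := hm
      rw [FractionalIdeal.mem_coe, FractionalIdeal.mem_inv_iff (FractionalIdeal.coeIdeal_ne_zero.mpr h𝔭0)] at hn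
      by_cases hmn : algebraMap T X.functionField a * n = 0
      · exact Or.inl hmn
      right
      have ha0 : baseToFunctionField π a ≠ 0 := fun h0 => hmn (by rw [halg, h0, zero_mul])
      have hn0 : n ≠ 0 := fun h0 => hmn (by rw [h0, mul_zero])
      have hv : ∀ a' ∈ (π.base γ).asIdeal, ∃ b : T,
          n * baseToFunctionField π a' = baseToFunctionField π b := by
        intro a' ha'
        have h1 := hn (algebraMap T _ a') (FractionalIdeal.mem_coeIdeal_of_mem _ ha')
        obtain ⟨b, hb⟩ := (FractionalIdeal.mem_one_iff (nonZeroDivisors T)).mp h1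
        refine ⟨b, ?_⟩
        rw [← halg a', ← halg b]
        exact hb.symm
      have hs : (-DΓ).IsSectionOn {y | π y ≠ closedPoint T} (baseToFunctionField π a) :=
        fun j y hyj hyE => neg_primeDivisor_isSectionOn_base π hX hγ ha𝔭 j y hyj (hcoh y hyE)
      have hs' : (-(-DΓ)).IsSectionOn {y | π y ≠ closedPoint T} n := by
        intro j y hyj hyE
        have h := primeDivisor_isSectionOn_of_mul_base_mem π hX hγ hπ hT.le hγE hv j y hyj ⟨hyE, hcoh y hyE⟩
        rw [CartierDivisor.neg_f, CartierDivisor.neg_f, inv_inv]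
        exact h
      intro i
      rw [halg]
      exact least_sub_greatest_le_ord_mul π hX F hF hFexc hFE hneg t (-DΓ) hD Z₀ A₀ hZ₀ hA₀ ha0 hn0 hs hs' i
    · -- sums
      rcases hy with hy0 | hy
      · rw [hy0, zero_add]; exact hz
      rcases hz with hz0 | hz
      · rw [hz0, add_zero]; exact Or.inr hy
      by_cases hyz : y + z = 0
      · exact Or.inl hyz
      right
      intro i
      haveI := isDiscreteValuationRing_stalk_of_coheight_eq_one hX (hF i i.2)
      exact (le_min (hy i) (hz i)).trans (Scheme.ord_add hyz)
  rcases hC with h0 | h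
  · exact absurd h0 (by
      rw [← halg]
      exact (map_ne_zero_iff _ (IsFractionRing.injective T X.functionField)).mpr hx0)
  · exact h i

end Ceiling

end Summit.ResolutionOfSingularities.ResolutionOfSingularities.Theorems.HomologicalConductor.PersistencePointedCeiling

end
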